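import Literature.MathematicalPhysics.QuantumFieldTheory.Balaban1983to89.B9Eq335CoveragePAtLettersY
import Literature.MathematicalPhysics.QuantumFieldTheory.Balaban1983to89.B9SectBGClassLettersY
import Literature.MathematicalPhysics.QuantumFieldTheory.Balaban1983to89.B9SectBGWordCurlHolY
import Literature.MathematicalPhysics.QuantumFieldTheory.Balaban1983to89.B9SectBCodedClassY
import Literature.MathematicalPhysics.QuantumFieldTheory.Balaban1983to89.B9SectBCodedClassR

/-!
# Balaban [B9], (3.35) p. 396 with (3.69) p. 404 («… follow directly from the assumptions (3.35)») — THE DISPLAYED CLASS LAW `hreg335P` OF THE ROW-13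
# G FRAME ((3.35) READ ON PLAQUETTES, `B9SectBGClassLettersY.Reg335PlaqY`) IS A THEOREM AT THE RECORD's READING OF PRINT's CLASS (`B9SectBCodedClassR.extraYPb`)
# for `𝔸 = M_N(ℂ)` (pub-ymgap N06, FLAG №8 road SOCKET-(α) ∕ CASCADE-R: one displayed law of `gFrame₅CodedOn` ∕ `sectBStepU_C37GY_unitary_of_members` fewer)

T. Bałaban, *Propagators for lattice gauge theories in a background field*, Commun. Math. Phys. **99** (1985) 389–434 [`Balaban1985BackgroundPropagators`, "B9"],
(3.35) p. 396 (the cube class, «O(1) will mean a number ≧ 10»), (3.69) p. 404; [4] = T. Bałaban, *Propagators and renormalization transformations for lattice gauge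
theories. II*, Commun. Math. Phys. **96** (1984) 223–250 [`Balaban1984PropagatorsII`], (2.2) p. 224, Lemma 2.1 (2.60) p. 234.

statement-level skeleton of published theorems with citation tags; proofs where landed; nothing here is a claim about the Yang–Mills mass gap

THE PRINT (verbatim, p. 404, after (3.69)): *«… the estimates follow directly from the assumptions (3.35), (3.37).»*  Our reading (as in dag-n06-j's
`B9Eq335CoveragePAtLettersY`, whose levelled plaquette bound this file consumes): every plaquette variable `U(∂p)` of a `G`-valued configuration `U` in print's
cube class (3.35) is within `O(1)·M·α₀·(Lʲη)⁻²`-type distance of `1`, `j` the level of the plaquette.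

WHY THIS FILE (cell context).  The G frame of row 13 (`B9SectBGFrameCodedY.gFrame₅CodedOn` and every consumer up to dag-n06-d's `sectBStepU_C37GY_unitary_of_members`)
DISPLAYS the class law `hreg335P : ∀ j α₀ U, MInv ≤ M → 0 < α₀ → M·α₀ ≤ aInv → (carrier).Reg335 c35 α₀ U → Reg335PlaqY G (f j) (ιB j) C₀ U` ((3.35) read on the
plaquettes through each bond, at the scale of the bond's block).  At MODULE 3's carrier `bg9Y` (class `cubeClass396`) it is NOT derivable (dag-n06-j: uncovered bonds);
at the record's reading of PRINT's class — the class-parametric carrier `bg9YC 𝔸 G P` of the CASCADE-R chain (director-ym №279) at `P := extraYPb 𝔸 G` — it IS: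
this file proves it, so the (α3) re-leaf (dag-n06-d) supplies `hreg335P := hreg335P_extraYPb …`, `C₀ := c335Plaq ℓ aInv` BY NAME.  No supplier of `Reg335PlaqY`
existed in the tree before this file.

THE ARGUMENT.  Let `⟨z, z+e_μ⟩` be a bond and `p = p_{mn}(y)` (`m < n`) a plaquette through it (`B9Eq369Small.Through`: `y ∈ {z, z − e_m, z − e_n}`).
(1) `(bg9YC (M_N ℂ) G extraYPb x).Reg335 c α₀ U` unfolds (`B9SectBCodedClassR.reg335C_iff`) to «`U` is `G`-valued» ∧ (`0 ≤ α₀` ∧ print's (3.35) over def-Y's class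
`cubeClassP x.toKIdx c35Y` with the per-cube constant `n·(M·α₀)`) ∧ (the same at the second pin) — i.e. def-Y's `(bg9KP (M_N ℂ) G x.toKIdx).Reg335 c35Y α₀ U`
at the FIRST pin.  (2) dag-n06-j's ★★★ `B9Eq335CoveragePAtLettersY.norm_holY_sub_one_le_levelled_of_reg335P` (`c35Y = 10 ≤ 10`): `‖U(∂p) − 1‖ ≤ B(K)·(L^{lev y − 1})⁻²`,
`B(K) = 2K(1+K)e^{4K}`, `K = 10·L·(M·α₀)`.  (3) NODE 00's plaquette variable IS pv27's `plaqU` in the chart (`B9SectBGWordCurlHolY.holY_eq_plaqU`), and the frame's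
coordinates at a `G`-valued base are the charted bond variables (`coordC (.base U) = UboxY U`).  (4) LEVELS: the base point `y` of a plaquette through `⟨z, z+e_μ⟩` has
its block within `2(d+1) < M` of the block of `z` (`B9SectBGClassLettersY.stencilThrough_blkC`), so the two block lengths differ by at most a factor `L`
(`B9RWSumsCompleteGeo9YNbr.len_le_of_dist_lt_M_geo9K`, [4] (2.2) + Lemma 2.1); with `ℓ(Δ(y)) = L^{lev y}·η` (`B9SectBCodedClassY.len_blkC_eq_scaleLen`) this gives
`L^{scale Δ(z)} ≤ L^{lev y + 1} ≤ L²·L^{lev y − 1}` (truncated subtraction included), hence `(L^{lev y − 1})⁻² ≤ L⁴·(L^{scale Δ(z)})⁻²`.  (5) `M·α₀ ≤ aInv` and the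
monotonicity of `B` (`plaqBound_mono`) make the constant member-uniform: `C₀ := c335Plaq ℓ aInv = B(10·L·aInv)·L⁴`, `L = ℓ + 1`.

WHAT IS PROVED (sorry-free; standard axioms; nothing of [B9] asserted — every printed input is a hypothesis of the cited suppliers, all PROVED in the tree).
* §1 `c335Plaq` (the constant, a closed real expression in `ℓ, aInv`), `c335Plaq_nonneg`; `pow_scale_blkC_le_of_through` (step (4)); `reg335KP_of_reg335C_extraYPb` (step (1)).
* §2 ★★ `reg335PlaqY_of_reg335C_extraYPb` — ONE member: `0 ≤ α₀`, `M·α₀ ≤ aInv`, `2(d+1) < M`, the class membership ⇒ `Reg335PlaqY G x ιB (c335Plaq ℓ aInv) U`.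
* §3 ★★★ `hreg335P_extraYPb` — the `hreg335P` BINDER OF `gFrame₅CodedOn` ∕ `sectBStepU_of_members` ∕ `sectBStepU_C37GY_unitary_of_members` at `P := extraYPb (M_N ℂ) G`,
  VERBATIM SHAPE (`∀ j α₀ U, MInv ≤ (geo9Y (f j)).M → 0 < α₀ → (geo9Y (f j)).M * α₀ ≤ aInv → (bg9YC … (extraYPb …) (f j)).Reg335 c35 α₀ U → Reg335PlaqY G (f j) (ιB j)
  (c335Plaq ℓ aInv) U`), from `hι` (sections of the block map — the frames' own binder) and `hMd : 2(d+1) < MInv` (the frames' own numeric binder).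

HONEST SCOPE.  Lattice geometry + bookkeeping over landed modules; ONE displayed law of the row-13 G frame discharged at print's class; the frame's other displayed
inputs (`hunitA` = Thm 3.11 at the record, `hplaq`, the numerics, the Lemma-2.1 datum, Thms 3.2 ∕ 3.3) untouched; NOT a node discharge; COUNT-NEUTRAL; N06 NOT
discharged; nothing continuum ∕ ℝ⁴ ∕ OS ∕ mass gap ∕ Clay.  Cell `pub-ymgap` (HUMAN RULING D-0062), Track A node N06 [B9], seat `pub-ymgap-dag-n06-c` g17, 2026-08-29.
NEW file; nothing landed is modified.  Net new unproved facts: 0.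
-/

noncomputable section

namespace Literature.MathematicalPhysics.QuantumFieldTheory.Balaban1983to89.B9SectBGReg335PlaqYOfClassPb

open Literature.MathematicalPhysics.QuantumFieldTheory.Balaban1983to89
open Literature.MathematicalPhysics.QuantumFieldTheory.Balaban1983to89.Node00 (SiteY BlkY FBondY IBondY CfgY UboxY shiftY holY PlaqY)
open Literature.MathematicalPhysics.QuantumFieldTheory.Balaban1983to89.Node00.OpsYNablaBridge (chartY)
open Literature.MathematicalPhysics.QuantumFieldTheory.Balaban1983to89.B6Ineq2142KLevelV1 (β)
open Literature.MathematicalPhysics.QuantumFieldTheory.Balaban1983to89.B6KLevelCensusIndexV1 (KIdx kGeo)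
open Literature.MathematicalPhysics.QuantumFieldTheory.Balaban1983to89.B9BackgroundsKLevelV1 (levV1)
open Literature.MathematicalPhysics.QuantumFieldTheory.Balaban1983to89.B6GlobalChartV1 (boxEquiv)
open Literature.MathematicalPhysics.QuantumFieldTheory.Balaban1983to89.B9GeoNormsKLevelV1 (geo9K)
open Literature.MathematicalPhysics.QuantumFieldTheory.Balaban1983to89.B9Eq39Adjoint (plaqU)
open Literature.MathematicalPhysics.QuantumFieldTheory.Balaban1983to89.B9Eq369Small (Through)
open Literature.MathematicalPhysics.QuantumFieldTheory.Balaban1983to89.B9PinMembersKLevelV1 (MemberY geo9Y bg9Y)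
open Literature.MathematicalPhysics.QuantumFieldTheory.Balaban1983to89.B9PinGeometryKLevelV1 (c35Y)
open Literature.MathematicalPhysics.QuantumFieldTheory.Balaban1983to89.B9BackgroundsKLevelV1P (bg9KP)
open Literature.MathematicalPhysics.QuantumFieldTheory.Balaban1983to89.B9SectBGpLettersY (GVal coordC blkC)
open Literature.MathematicalPhysics.QuantumFieldTheory.Balaban1983to89.B9SectBCodedCarrier (CCfg)
open Literature.MathematicalPhysics.QuantumFieldTheory.Balaban1983to89.B9SectBGClassLettersY (Reg335PlaqY stencilThrough_blkC)
open Literature.MathematicalPhysics.QuantumFieldTheory.Balaban1983to89.B9SectBCodedClassY (len_blkC_eq_scaleLen)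
open Literature.MathematicalPhysics.QuantumFieldTheory.Balaban1983to89.B9SectBCodedClassR (RegExtraY bg9YC extraYPb)
open Literature.MathematicalPhysics.QuantumFieldTheory.Balaban1983to89.B9Eq335CoveragePAtLettersY (plaqBound_mono norm_holY_sub_one_le_levelled_of_reg335P)
open Literature.MathematicalPhysics.QuantumFieldTheory.Balaban1983to89.B9SectBGWordCurlHolY (holY_eq_plaqU)
open Literature.MathematicalPhysics.QuantumFieldTheory.Balaban1983to89.B9RWSumsCompleteGeo9YNbr (len_le_of_dist_lt_M_geo9K)

variable {d ℓ : ℕ} {hd : 1 ≤ d + 1} {hL : Odd (ℓ + 1) ∧ 1 < ℓ + 1} {b₀ b₁ : ℝ} {Mstar N : ℕ}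

/-! ## §1 The constant; the level step; the class membership at the first pin -/

section Constant

/-- **the member-uniform (3.35) plaquette constant at print's class**: `c335Plaq ℓ aInv = 2K(1+K)e^{4K}·L⁴` with `K = 10·L·aInv`, `L = ℓ + 1` — dag-n06-j's per-cube bound
`2C(1+C)e^{4C}` at the largest admissible cube datum `C = 10L·(M·α₀) ≤ 10L·aInv`, times `L⁴` for the two one-level slacks of step (4).
[cite: Balaban1985BackgroundPropagators, (3.35) p.396, (3.69) p.404 (bookkeeping: a witness, not optimised)] -/
def c335Plaq (ℓ : ℕ) (aInv : ℝ) : ℝ :=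
  2 * (10 * ((ℓ : ℝ) + 1) * aInv) * (1 + 10 * ((ℓ : ℝ) + 1) * aInv) * Real.exp (4 * (10 * ((ℓ : ℝ) + 1) * aInv)) * ((ℓ : ℝ) + 1) ^ 4

/-- `0 ≤ c335Plaq ℓ aInv` for `0 ≤ aInv` (the frames' `hC₀`). [cite: Balaban1985BackgroundPropagators, (3.35) p.396 (bookkeeping)] -/
theorem c335Plaq_nonneg (ℓ : ℕ) {aInv : ℝ} (ha : 0 ≤ aInv) : 0 ≤ c335Plaq ℓ aInv := by
  unfold c335Plaq
  have : (0 : ℝ) ≤ (ℓ : ℝ) + 1 := by positivity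
  positivity

end Constant

section Levels

variable (i : KIdx d ℓ hd hL b₀ b₁) (ιB : BlkY i → IBondY i)

/-- ★ **THE LEVEL STEP (4)**: for a plaquette `p_{mn}(y)` THROUGH the bond `⟨z, z+e_μ⟩` (`2(d+1) < M`, `ιB` a section of the block map),
`L^{scale Δ(z)} ≤ L²·L^{lev y − 1}` (`lev y` = MODULE 2's `levV1` at the chart preimage of `y`; truncated subtraction) — the blocks of `z` and `y` are within `2(d+1)` of
each other, so their lengths differ by at most a factor `L` ([4] (2.2) + Lemma 2.1 (2.60)), and one more factor `L` absorbs the `− 1`.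
[cite: Balaban1984PropagatorsII, (2.2) p.224, Lemma 2.1 (2.60) p.234; Balaban1985BackgroundPropagators, p.397 (after (3.41)), p.404 (after (3.69))] -/
theorem pow_scale_blkC_le_of_through (hι : ∀ s : BlkY i, β i.hN i.D i.hk (ιB s) = s) (hdM : 2 * ((d : ℝ) + 1) < (geo9K i).M)
    {μ : Fin (d + 1)} {z : SiteY i} {m n : Fin (d + 1)} {y : SiteY i} (h : Through (shiftY i) μ z m n y) :
    (geo9K i).L ^ (geo9K i).scale (blkC i ιB z) ≤ (geo9K i).L ^ 2 * (geo9K i).L ^ (levV1 i ((boxEquiv i.hN).symm y) - 1) := by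
  have hdist := stencilThrough_blkC i ιB hι h
  have hlen := len_le_of_dist_lt_M_geo9K i (lt_of_le_of_lt hdist hdM)
  -- `ℓ(Δ(z)) = L^{scale Δ(z)}·η`, `ℓ(Δ(y)) = L^{lev y}·η`
  have hy : (geo9K i).len (blkC i ιB y) = (geo9K i).L ^ levV1 i ((boxEquiv i.hN).symm y) * (geo9K i).eta := by
    rw [len_blkC_eq_scaleLen i ιB hι y]; rfl
  have hz : (geo9K i).len (blkC i ιB z) = (geo9K i).L ^ (geo9K i).scale (blkC i ιB z) * (geo9K i).eta := rfl
  have hL : (geo9K i).L = ((ℓ + 1 : ℕ) : ℝ) := rfl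
  have hη : 0 < (geo9K i).eta := B9Eq335PlaquetteAtLettersY.eta_pos i
  have hL1 : (1 : ℝ) ≤ (geo9K i).L := by rw [hL]; exact_mod_cast Nat.succ_le_succ (Nat.zero_le ℓ)
  rw [hz, hy, ← hL] at hlen
  -- divide by `η > 0`: `L^{scale Δ(z)} ≤ L·L^{lev y} = L^{lev y + 1}`
  have h1 : (geo9K i).L ^ (geo9K i).scale (blkC i ιB z) ≤ (geo9K i).L ^ (levV1 i ((boxEquiv i.hN).symm y) + 1) := by
    have h' : (geo9K i).L ^ (geo9K i).scale (blkC i ιB z) * (geo9K i).eta ≤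
        (geo9K i).L ^ (levV1 i ((boxEquiv i.hN).symm y) + 1) * (geo9K i).eta := by
      calc _ ≤ (geo9K i).L * ((geo9K i).L ^ levV1 i ((boxEquiv i.hN).symm y) * (geo9K i).eta) := hlen
        _ = _ := by rw [pow_succ]; ring
    exact le_of_mul_le_mul_right h' hη
  -- `lev y + 1 ≤ (lev y − 1) + 2`
  have h2 : (geo9K i).L ^ (levV1 i ((boxEquiv i.hN).symm y) + 1) ≤ (geo9K i).L ^ (levV1 i ((boxEquiv i.hN).symm y) - 1 + 2) :=
    pow_le_pow_right₀ hL1 (by omega)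
  calc (geo9K i).L ^ (geo9K i).scale (blkC i ιB z) ≤ (geo9K i).L ^ (levV1 i ((boxEquiv i.hN).symm y) - 1 + 2) := h1.trans h2
    _ = (geo9K i).L ^ 2 * (geo9K i).L ^ (levV1 i ((boxEquiv i.hN).symm y) - 1) := by rw [pow_add, mul_comm]

end Levels

section ClassPb

open scoped Matrix.Norms.L2Operator

variable (G : Subgroup (Matrix (Fin N) (Fin N) ℂ)ˣ) (x : MemberY d ℓ hd hL b₀ b₁ Mstar)

/-- ★ **STEP (1) — THE CLASS MEMBERSHIP AT THE FIRST PIN**: `(bg9YC (M_N ℂ) G extraYPb x).Reg335 c α₀ U` (shape `(GVal ∧ (0 ≤ α₀ ∧ (3.35) over cubeClassP at c35Y)) ∧ …`,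
`B9SectBCodedClassR.reg335C_iff`) gives def-Y's `(bg9KP (M_N ℂ) G x.toKIdx).Reg335 c35Y α₀ U` (= «`U` is `G`-valued» ∧ the same (3.35) clause) and `0 ≤ α₀`.
[cite: Balaban1985BackgroundPropagators, (3.35) p.396 (bookkeeping)] -/
theorem reg335KP_of_reg335C_extraYPb {c α₀ : ℝ} {U : CfgY (Matrix (Fin N) (Fin N) ℂ) x.toKIdx}
    (hU : (bg9YC (Matrix (Fin N) (Fin N) ℂ) G (extraYPb (d := d) (ℓ := ℓ) (hd := hd) (hL := hL) (b₀ := b₀) (b₁ := b₁) (Mstar := Mstar)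
      (Matrix (Fin N) (Fin N) ℂ) G) x).Reg335 c α₀ U) :
    (bg9KP (Matrix (Fin N) (Fin N) ℂ) G x.toKIdx).Reg335 c35Y α₀ U ∧ 0 ≤ α₀ :=
  ⟨⟨hU.1.1, hU.1.2.2⟩, hU.1.2.1⟩

end ClassPb

/-! ## §2 ★★ (3.35) on plaquettes at one member -/

section Member

open scoped Matrix.Norms.L2Operator

variable (G : Subgroup (Matrix (Fin N) (Fin N) ℂ)ˣ) (x : MemberY d ℓ hd hL b₀ b₁ Mstar) (ιB : BlkY x.toKIdx → IBondY x.toKIdx)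

/-- ★★ **PRINT's (3.35) READ ON THE PLAQUETTES THROUGH EVERY BOND, AT THE SCALE OF THE BOND's BLOCK — ONE MEMBER** (`𝔸 = M_N(ℂ)`, `N ≥ 1`): at a configuration
`U` of the class-parametric carrier at the record's reading of print's class (`bg9YC (M_N ℂ) G extraYPb x`, threshold slot `c` inert, `0 ≤ α₀` inside), with
`M·α₀ ≤ aInv` and `2(d+1) < M`, the frame's law `Reg335PlaqY G x ιB (c335Plaq ℓ aInv) U` holds: for every bond `⟨z, z+e_μ⟩` and every plaquette `p_{mn}(y)` through it,
`‖U(∂p) − 1‖ ≤ c335Plaq ℓ aInv · (L^{scale Δ(z)})⁻²`.  Steps (1)–(5) of the header. [cite: Balaban1985BackgroundPropagators, (3.35) p.396, (3.69) p.404; Balaban1984PropagatorsII, (2.2) p.224, Lemma 2.1 (2.60) p.234] -/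
theorem reg335PlaqY_of_reg335C_extraYPb [Nonempty (Fin N)] (hι : ∀ s : BlkY x.toKIdx, β x.toKIdx.hN x.toKIdx.D x.toKIdx.hk (ιB s) = s)
    (hdM : 2 * ((d : ℝ) + 1) < (geo9Y x).M) {aInv c α₀ : ℝ} {U : CfgY (Matrix (Fin N) (Fin N) ℂ) x.toKIdx}
    (hMa : (geo9Y x).M * α₀ ≤ aInv)
    (hU : (bg9YC (Matrix (Fin N) (Fin N) ℂ) G (extraYPb (d := d) (ℓ := ℓ) (hd := hd) (hL := hL) (b₀ := b₀) (b₁ := b₁) (Mstar := Mstar)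
      (Matrix (Fin N) (Fin N) ℂ) G) x).Reg335 c α₀ U) :
    Reg335PlaqY G x ιB (c335Plaq ℓ aInv) U := by
  obtain ⟨hKP, hα⟩ := reg335KP_of_reg335C_extraYPb G x hU
  have hGV : GVal G x.toKIdx U := hU.1.1
  have hco : coordC G x.toKIdx (.base U) = UboxY x.toKIdx U := by
    simp only [coordC, if_pos hGV]
  -- numerics of the member
  have hM0 : 0 < (geo9Y x).M := lt_of_le_of_lt (by positivity) hdM
  have hMα : 0 ≤ (kGeo x.toKIdx).M * α₀ := by
    show 0 ≤ (geo9Y x).M * α₀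
    exact mul_nonneg hM0.le hα
  have hL : (kGeo x.toKIdx).L = (ℓ : ℝ) + 1 := by show (((ℓ + 1 : ℕ) : ℝ)) = _; push_cast; ring
  have hL1 : (1 : ℝ) ≤ (kGeo x.toKIdx).L := by rw [hL]; linarith [(Nat.cast_nonneg ℓ : (0 : ℝ) ≤ ℓ)]
  have hL0 : (0 : ℝ) < (kGeo x.toKIdx).L := lt_of_lt_of_le one_pos hL1
  have hc : c35Y ≤ 10 := le_of_eq rfl
  -- the per-member datum is below the uniform one: `K = 10L(Mα₀) ≤ 10L·aInv`
  have hK : 10 * (kGeo x.toKIdx).L * ((kGeo x.toKIdx).M * α₀) ≤ 10 * ((ℓ : ℝ) + 1) * aInv := by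
    rw [hL]
    have hMa' : (kGeo x.toKIdx).M * α₀ ≤ aInv := hMa
    exact mul_le_mul_of_nonneg_left hMa' (by positivity)
  have hK0 : 0 ≤ 10 * (kGeo x.toKIdx).L * ((kGeo x.toKIdx).M * α₀) := by positivity
  have hB := plaqBound_mono hK0 hK
  intro μ z m n y hthr
  -- the plaquette `p_{mn}(y)` as a NODE 00 plaquette based at the chart preimage of `y`
  let p : PlaqY x.toKIdx := ⟨(chartY x.toKIdx).symm y, m, n, hthr.1⟩
  have hp : chartY x.toKIdx p.src = y := Equiv.apply_symm_apply _ y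
  have key := norm_holY_sub_one_le_levelled_of_reg335P x.toKIdx U hc hMα hKP p
  rw [holY_eq_plaqU, hp] at key
  rw [hco]
  -- levels: `(L^{lev y − 1})⁻² ≤ L⁴ · (L^{scale Δ(z)})⁻²`
  have hlev := pow_scale_blkC_le_of_through x.toKIdx ιB hι hdM hthr
  have hps : (0 : ℝ) < (geo9K x.toKIdx).L ^ (geo9K x.toKIdx).scale (blkC x.toKIdx ιB z) := pow_pos hL0 _
  have hpy : (0 : ℝ) < (geo9K x.toKIdx).L ^ (levV1 x.toKIdx ((boxEquiv x.toKIdx.hN).symm y) - 1) := pow_pos hL0 _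
  have hinv : ((kGeo x.toKIdx).L ^ (levV1 x.toKIdx p.src - 1))⁻¹ ≤
      (kGeo x.toKIdx).L ^ 2 * ((geo9Y x).L ^ (geo9Y x).scale (blkC x.toKIdx ιB z))⁻¹ := by
    show ((geo9K x.toKIdx).L ^ (levV1 x.toKIdx ((boxEquiv x.toKIdx.hN).symm y) - 1))⁻¹ ≤
      (geo9K x.toKIdx).L ^ 2 * ((geo9K x.toKIdx).L ^ (geo9K x.toKIdx).scale (blkC x.toKIdx ιB z))⁻¹
    rw [inv_le_comm₀ hpy (by positivity), mul_inv, inv_inv, inv_mul_le_iff₀ (by positivity)]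
    exact hlev
  have hinv0 : 0 ≤ ((kGeo x.toKIdx).L ^ (levV1 x.toKIdx p.src - 1))⁻¹ := by positivity
  have hsq : (((kGeo x.toKIdx).L ^ (levV1 x.toKIdx p.src - 1))⁻¹) ^ 2 ≤
      (kGeo x.toKIdx).L ^ 4 * (((geo9Y x).L ^ (geo9Y x).scale (blkC x.toKIdx ιB z))⁻¹) ^ 2 := by
    have := mul_le_mul hinv hinv hinv0 (by positivity)
    calc (((kGeo x.toKIdx).L ^ (levV1 x.toKIdx p.src - 1))⁻¹) ^ 2
        = ((kGeo x.toKIdx).L ^ (levV1 x.toKIdx p.src - 1))⁻¹ * ((kGeo x.toKIdx).L ^ (levV1 x.toKIdx p.src - 1))⁻¹ := sq _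
      _ ≤ ((kGeo x.toKIdx).L ^ 2 * ((geo9Y x).L ^ (geo9Y x).scale (blkC x.toKIdx ιB z))⁻¹) *
            ((kGeo x.toKIdx).L ^ 2 * ((geo9Y x).L ^ (geo9Y x).scale (blkC x.toKIdx ιB z))⁻¹) := this
      _ = (kGeo x.toKIdx).L ^ 4 * (((geo9Y x).L ^ (geo9Y x).scale (blkC x.toKIdx ιB z))⁻¹) ^ 2 := by ring
  -- assemble
  have hB0 : 0 ≤ 2 * (10 * ((ℓ : ℝ) + 1) * aInv) * (1 + 10 * ((ℓ : ℝ) + 1) * aInv) * Real.exp (4 * (10 * ((ℓ : ℝ) + 1) * aInv)) := by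
    have ha : 0 ≤ 10 * ((ℓ : ℝ) + 1) * aInv := hK0.trans hK
    positivity
  calc ‖(plaqU (shiftY x.toKIdx) (UboxY x.toKIdx U) m n y : Matrix (Fin N) (Fin N) ℂ) - 1‖
      ≤ 2 * (10 * (kGeo x.toKIdx).L * ((kGeo x.toKIdx).M * α₀)) * (1 + 10 * (kGeo x.toKIdx).L * ((kGeo x.toKIdx).M * α₀)) *
          Real.exp (4 * (10 * (kGeo x.toKIdx).L * ((kGeo x.toKIdx).M * α₀))) * (((kGeo x.toKIdx).L ^ (levV1 x.toKIdx p.src - 1))⁻¹) ^ 2 := key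
    _ ≤ 2 * (10 * ((ℓ : ℝ) + 1) * aInv) * (1 + 10 * ((ℓ : ℝ) + 1) * aInv) * Real.exp (4 * (10 * ((ℓ : ℝ) + 1) * aInv)) *
          ((kGeo x.toKIdx).L ^ 4 * (((geo9Y x).L ^ (geo9Y x).scale (blkC x.toKIdx ιB z))⁻¹) ^ 2) :=
        mul_le_mul hB hsq (sq_nonneg _) hB0
    _ = c335Plaq ℓ aInv * (((geo9Y x).L ^ (geo9Y x).scale (blkC x.toKIdx ιB z))⁻¹) ^ 2 := by
        rw [c335Plaq, hL]; ring

end Member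

/-! ## §3 ★★★ The `hreg335P` binder of the row-13 G frame at `P := extraYPb`, verbatim shape -/

section Binder

open scoped Matrix.Norms.L2Operator

variable (G : Subgroup (Matrix (Fin N) (Fin N) ℂ)ˣ) {J : Type} (f : J → MemberY d ℓ hd hL b₀ b₁ Mstar)
  (ιB : ∀ j : J, BlkY (f j).toKIdx → IBondY (f j).toKIdx)

/-- ★★★ **THE DISPLAYED CLASS LAW `hreg335P` OF `gFrame₅CodedOn` ∕ `h1GFrame₆CodedOn` ∕ `e4h2GFrame₆CodedOn` ∕ `l2GFrame₈CodedOn` ∕ `sectBStepU_of_members` ∕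
`sectBStepU_C37GY_unitary_of_members` (CASCADE-R twins) IS A THEOREM AT `P := extraYPb (M_N ℂ) G`** (`N ≥ 1`), with `C₀ := c335Plaq ℓ aInv`: VERBATIM the binder's
shape — for every member `j`, every `α₀ > 0` with `M·α₀ ≤ aInv` at `M ≥ MInv > 2(d+1)`, every `U` in the carrier's (3.35) class, `Reg335PlaqY G (f j) (ιB j) C₀ U`.
Inputs: the frames' own `hι` (sections of the block maps) and `hMd : 2(d+1) < MInv`.  Print p. 404: «… follow directly from the assumptions (3.35)».
[cite: Balaban1985BackgroundPropagators, (3.35) p.396, (3.69) p.404; Balaban1984PropagatorsII, (2.2) p.224, Lemma 2.1 (2.60) p.234] -/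
theorem hreg335P_extraYPb [Nonempty (Fin N)]
    (hι : ∀ (j : J) (s : BlkY (f j).toKIdx), β (f j).toKIdx.hN (f j).toKIdx.D (f j).toKIdx.hk (ιB j s) = s)
    {MInv : ℝ} (hMd : 2 * ((d : ℝ) + 1) < MInv) (aInv c35 : ℝ) :
    ∀ (j : J) (α₀ : ℝ) (U : CfgY (Matrix (Fin N) (Fin N) ℂ) (f j).toKIdx), MInv ≤ (geo9Y (f j)).M → 0 < α₀ → (geo9Y (f j)).M * α₀ ≤ aInv →
      (bg9YC (Matrix (Fin N) (Fin N) ℂ) G (extraYPb (d := d) (ℓ := ℓ) (hd := hd) (hL := hL) (b₀ := b₀) (b₁ := b₁) (Mstar := Mstar)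
        (Matrix (Fin N) (Fin N) ℂ) G) (f j)).Reg335 c35 α₀ U →
        Reg335PlaqY G (f j) (ιB j) (c335Plaq ℓ aInv) U :=
  fun j _α₀ _U hM _hα hMa hU => reg335PlaqY_of_reg335C_extraYPb G (f j) (ιB j) (hι j) (lt_of_lt_of_le hMd hM) hMa hU

end Binder

end Literature.MathematicalPhysics.QuantumFieldTheory.Balaban1983to89.B9SectBGReg335PlaqYOfClassPb

end
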